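import Literature.Computability.Cryptography.VDSCopyLayout
import Literature.Computability.QuantumComplexity.SegmentState
import Literature.Computability.Cryptography.KitaevBlockEmbedded
import Literature.Computability.QuantumComplexity.ReversibleCliffordT
import HarnessLib

/-!
# The van Dam–Seroussi copy, III: the circuit

Topic `Literature/Computability/Cryptography`; sequel of `VDSCopyLayout.lean` for the discharge of
`VanDamSeroussi2002_gaussSumPhase_qsolvable`. The gate list of ONE copy of the gadget-free
realisation of van Dam–Seroussi's Algorithm 1 (2002, §4) — Hadamard-test copy of type `t`
(`t = true`: an `S` gate before the final Hadamard, the sine test) — over `{H, S, T, CNOT}` and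
oracle gates for `VDSOracle.lang₂`, on the `bw P` wires of the layout:

* `constWord` — `X = HSSH` (`xWord`) on every wire of a constant segment (the headers, the register
  `Bc` holding `bin b`) whose bit is set: the copy starts from `|0…0⟩`;
* `xgates k` — the oracle XOR block `k` as gates; `tyE`/`tyZ` — the test types of the two eigenvalue
  measurements (control `j` of block size `B` is a sine test iff `⌊j/B⌋` is odd);
* **`copyCircuit P t`** — constants; `H` on `S`, `T`, `J`; `Fc ← FACT`; Kitaev's block on `TE` around
  the shift pair (mode measurement, Kitaev 1995 §3/§5); `U ← RECONP`; preparation, discrete logarithm,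
  kick-back, erasures; periodisation; Kitaev's block on `TZ` around the shift pair (Fourier read-out);
  `K ← RECONK`; un-phase kick-back and erasures; `Db ← DLOG(b)`; `[t] S` and `H` on `S`.

Definitions with bodies (`stage`-wise, so that the semantics is a chain of `toMatrix_append`);
no named fact.

## References

* W. van Dam, G. Seroussi, arXiv:quant-ph/0207131 (2002), §4 Algorithm 1 [VanDamSeroussi2002].
* A. Yu. Kitaev, arXiv:quant-ph/9511026 (1995), §3, §5 [Kitaev1995].
* M. A. Nielsen, I. L. Chuang, CUP 2010, §4.2 Ex. 4.18 (`X = HZH`, `Z = S²`) [NielsenChuang2010].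
-/

noncomputable section

namespace Literature.Computability.Cryptography

namespace VDSCopy

open _root_.Computability Complexity QuantumComplexity QuantumComplexity.SegLayout VDSOracle

variable (P : Prm)

/-! ### Constants -/

/-- The `X` words setting the true bits of a string on consecutive wires of a segment. [cite: NielsenChuang2010, §4.2 Ex. 4.18] -/
def setBits {m : ℕ} (e : Fin m ↪ Fin (bw P)) (s : List Bool) : List (QGate cliffordT (bw P)) :=
  (List.finRange m).flatMap fun i : Fin m => if s.getD i false then xWord (e i) else []

/-- **The constant-setting word**: the header strings on the header segments, `bin b` on `Bc`.
[cite: VanDamSeroussi2002, §4 Algorithm 1] -/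
def constWord : List (QGate cliffordT (bw P)) :=
  ((List.range 26).flatMap fun k => (List.finRange (wd P (op P k).dst)).flatMap fun i =>
      setBits P ((xblock P k).hdr i) (hdrStr P (op P k) i)) ++
    setBits P (reg P R.Bc) (bits (wd P R.Bc) P.b)

/-! ### Blocks and test types -/

/-- The oracle XOR block `k` as gates. [folklore] -/
def xgates (k : ℕ) : List (QGate cliffordT (bw P)) := (xblock P k).gates.map OracleXor.OGate.toGate

/-- The test type of control `j` for blocks of size `B`: sine iff `⌊j/B⌋` is odd. [cite: Kitaev1995, §3 Remark 8] -/
def tyOfB (B j : ℕ) : Bool := decide ((j / B) % 2 = 1)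

/-- Test types of the mode measurement. [folklore] -/
def tyE (j : Fin (wd P R.TE)) : Bool := tyOfB P.BE j

/-- Test types of the Fourier read-out. [folklore] -/
def tyZ (j : Fin (wd P R.TZ)) : Bool := tyOfB P.BZ j

/-! ### The stages -/

/-- Stage A: constants and the three Hadamard layers (`S`, `T`, `J`). [cite: VanDamSeroussi2002, §4 Algorithm 1] -/
def stageA : QCircuit cliffordT (bw P) :=
  ⟨constWord P ++ KitaevEmb.hLayer (reg P R.S) ++ KitaevEmb.hLayer (reg P R.T) ++ KitaevEmb.hLayer (reg P R.J)⟩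

/-- Stage B: the certificate and the mode measurement with its reconstruction
(`Fc ← FACT`; Kitaev block on `TE`; `U ← RECONP`). [cite: Kitaev1995, §3, §5] -/
def stageB : QCircuit cliffordT (bw P) :=
  ⟨xgates P 0 ++ (KitaevEmb.block (reg P R.TE) (xgates P 1 ++ xgates P 2) (tyE P)).gates ++ xgates P 3⟩

/-- Stage C: preparation, discrete logarithm, kick-back, erasures (blocks `4–12`). [cite: VanDamSeroussi2002, §3 Lemma 1, §4] -/
def stageC : QCircuit cliffordT (bw P) :=
  ⟨xgates P 4 ++ xgates P 5 ++ xgates P 6 ++ xgates P 7 ++ xgates P 8 ++ xgates P 9 ++ xgates P 10 ++ xgates P 11 ++ xgates P 12⟩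

/-- Stage D: periodisation (blocks `13–15`). [cite: Hales2002, Ch. 5 §1 Algorithm 3] -/
def stageD : QCircuit cliffordT (bw P) :=
  ⟨xgates P 13 ++ xgates P 14 ++ xgates P 15⟩

/-- Stage E: the Fourier read-out (Kitaev block on `TZ`; `K ← RECONK`). [cite: Kitaev1995, §5] -/
def stageE : QCircuit cliffordT (bw P) :=
  ⟨(KitaevEmb.block (reg P R.TZ) (xgates P 16 ++ xgates P 17) (tyZ P)).gates ++ xgates P 18⟩

/-- Stage F: un-phase kick-back, erasures, and `Db ← DLOG(b)` (blocks `19–25`). [cite: VanDamSeroussi2002, §4 Algorithm 1 step 3] -/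
def stageF : QCircuit cliffordT (bw P) :=
  ⟨xgates P 19 ++ xgates P 20 ++ xgates P 21 ++ xgates P 22 ++ xgates P 23 ++ xgates P 24 ++ xgates P 25⟩

/-- Stage G: the read-out basis change on `S` (`[t] S`, then `H`). [cite: VanDamSeroussi2002, §4 (Fact 2)] -/
def stageG (t : Bool) : QCircuit cliffordT (bw P) :=
  ⟨(if t then [sOn (reg P R.S ⟨0, by show 0 < 1; norm_num⟩)] else []) ++ KitaevEmb.hLayer (reg P R.S)⟩

/-- **The circuit of one copy** of type `t`. [cite: VanDamSeroussi2002, §4 Algorithm 1] -/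
def copyCircuit (t : Bool) : QCircuit cliffordT (bw P) :=
  ((((((stageA P).append (stageB P)).append (stageC P)).append (stageD P)).append (stageE P)).append (stageF P)).append (stageG P t)

end VDSCopy

end Literature.Computability.Cryptography

end
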